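/-
b2b-lace packet, LEAN TYPING SEAT 2 gen 16 (unit `b2b-lace-lean2-g16`).  (S2b)-IMPR ASSEMBLY node, FREE FORM (REFEREE v73 ORDERS (4): the Step-1
bound to be typed is tail-g9's slot-wise `boundH1D80`, NOT the printed (3.61) table entry `F3Bounds.boundH1` — DIVERGENCE D80; D77/D82 may move other
summands): [NoBLE17] (3.59) + triangle inequality with the five per-piece bounds as FREE reals `B₁,…,B₅`, so that every present and future cell-bound
function (printed `boundH`, `boundHD75` of rev 8/9, a `boundHD80` with Step 1 re-derived) instantiates it by name.  Companion of
`NobleWeightedDiagramAssembly` (p193098, the `boundHD75` instance with the H₄ leaf consumed), whose a.e. split lemma it imports; d-generic; NEW module.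
-/
import Literature.Probability.FitznerVanDerHofstad2017.NobleWeightedDiagramAssembly
import HarnessLib

/-!
# Literature.Probability.FitznerVanDerHofstad2017.NobleWeightedDiagramSum — `|ℋ^{n,l}_p(x)| ≤ B₁ + B₂ + B₃ + B₄ + B₅` ([NoBLE17] (3.59), free form)

[NoBLE17] = R. Fitzner, R. van der Hofstad, *Generalized approach to the non-backtracking lace expansion*, PTRF 169 (2017) 1041–1119, §3.3.5:

> (3.58) `ℋ^{n,l}_{i,z}(x) = ∫ Ĥ_i(k) D̂(k)^l Ĝ_z(k)ⁿ D̂^{(x)}(k) dk/(2π)^d`,  (3.59) `ℋ^{n,l}_z(x) = Σ_{i=1}^5 ℋ^{n,l}_{i,z}(x)`.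

THIS MODULE: for percolation below `p_c`, a simplified-form witness `(c_Φ, α_Φ, c_F, α_F, R_Φ, R_F)` of `τ̂_p` with summable remainders of finite
absolute second moment whose atoms `lapAtomsAt …` obey `KeyBounds r` on the cube off `{D̂ = 1}`, integrable pieces (`NobleLapAtomsIntegrable`,
p193161, discharges `hI1`–`hI5` by name) and ANY reals `B₁, …, B₅` bounding the five piece integrals, `|ℋ^{n,l}_p(x)| ≤ B₁ + B₂ + B₃ + B₄ + B₅`.
It is the table-free kernel of the assembly: `NobleWeightedDiagramAssembly.abs_nobleH_le_boundHD75_of_pieces` (p193098) is the instance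
`B_i = (boundH1, boundH2, boundH3, boundH4D75, boundH5) τ n l x r` with `B₄` discharged by `NobleH4StepD75`; the D80 line (Step 1 re-derived: (3.61)/(3.62)
hold as displayed only at `α_F = 1`, tail-g9 / REFEREE v73 W73.1) will instantiate `B₁ := boundH1D80 …` once that function is typed, with `B₂, B₃, B₅`
from `NobleH2Step` (under the displayed (H-Γ), (H-T) of D79) and `NobleH35Step`.  No analytic fact is asserted: linearity of the integral over the
a.e. split `D̂^{(x)} · tauWHat · τ̂_pⁿ · D̂^l = Σ_i Ĥ_i Ĝⁿ D̂^l D̂^{(x)}` (`tauWHat_eq_sum_H`, `nobleH_eq_integral`) and `|Σ| ≤ Σ|·|`.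
[cite: FitznerVanDerHofstad2016NoBLE, §3.3.5 (3.58)–(3.59) p. 1074; §3.3.4 (3.52)–(3.57) pp. 1073–1074; §3.3.1 (3.9)–(3.10) p. 1067]
-/

noncomputable section

open MeasureTheory Real
open Literature.Barriers.CriticalPhenomena
open Literature.Barriers.CriticalPhenomena.Slade2006Prop53 (P)
open Literature.Probability.LatticeModels
open Literature.Probability.Percolation
open Literature.Probability.RandomPlanarGeometry.SAW.Zd (normSq)

namespace Literature.Probability.FitznerVanDerHofstad2017

variable {d : ℕ}

/-- **[NoBLE17] (3.59) with the triangle inequality, free form: `|ℋ^{n,l}_p(x)| ≤ B₁ + B₂ + B₃ + B₄ + B₅`** for any reals bounding the five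
piece integrals `|∫ Ĥ_i Ĝⁿ D̂^l D̂^{(x)} dk/(2π)^d| ≤ B_i`.  Hypotheses: `d ≥ 2`, `p < p_c`, the simplified-form witness (`hform`) with summable
remainders of finite absolute second moment, `KeyBounds r` on the cube off `{D̂ = 1}`, integrability of the five signed pieces (`hI1`–`hI5`,
`NobleLapAtomsIntegrable.integrable_piece_H1…5`), and the five bounds `hH1`–`hH5` (the leaves: L3 Step 1 — D80 form owed; `NobleH2Step`;
`NobleH35Step`; `NobleH4StepD75`).
[cite: FitznerVanDerHofstad2016NoBLE, §3.3.5 (3.58)–(3.59) p. 1074] -/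
theorem abs_nobleH_le_of_piece_bounds {n : ℕ} (hd : 2 ≤ d) {p : unitInterval}
    (hp : (p : ℝ) < criticalProb (zdGraph d) (0 : Site d)) {cΦ αΦ cF αF : ℝ} {RΦ RF : Site d → ℝ}
    (hRΦ : Summable RΦ) (hRF : Summable RF) (hRΦ2 : Summable fun x => normSq x * |RΦ x|)
    (hRF2 : Summable fun x => normSq x * |RF x|)
    (hform : ∀ k ∈ cube d,
      tauHat d p k * (1 - (cF + αF * Dhat d k + cosFT RF k)) = cΦ + αΦ * Dhat d k + cosFT RΦ k)
    {r : F3Bounds.Args} (hKB : ∀ k ∈ cube d, Dhat d k < 1 → (lapAtomsAt d cΦ αΦ cF αF RΦ RF k).KeyBounds r)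
    (l : ℕ) (x : Site d)
    (hI1 : Integrable (fun k => (lapAtomsAt d cΦ αΦ cF αF RΦ RF k).H1 * (lapAtomsAt d cΦ αΦ cF αF RΦ RF k).G ^ n *
      Dhat d k ^ l * DhatSym d x k) (P d))
    (hI2 : Integrable (fun k => (lapAtomsAt d cΦ αΦ cF αF RΦ RF k).H2 * (lapAtomsAt d cΦ αΦ cF αF RΦ RF k).G ^ n *
      Dhat d k ^ l * DhatSym d x k) (P d))
    (hI3 : Integrable (fun k => (lapAtomsAt d cΦ αΦ cF αF RΦ RF k).H3 * (lapAtomsAt d cΦ αΦ cF αF RΦ RF k).G ^ n *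
      Dhat d k ^ l * DhatSym d x k) (P d))
    (hI4 : Integrable (fun k => (lapAtomsAt d cΦ αΦ cF αF RΦ RF k).H4 * (lapAtomsAt d cΦ αΦ cF αF RΦ RF k).G ^ n *
      Dhat d k ^ l * DhatSym d x k) (P d))
    (hI5 : Integrable (fun k => (lapAtomsAt d cΦ αΦ cF αF RΦ RF k).H5 * (lapAtomsAt d cΦ αΦ cF αF RΦ RF k).G ^ n *
      Dhat d k ^ l * DhatSym d x k) (P d)) {B₁ B₂ B₃ B₄ B₅ : ℝ}
    (hH1 : |(∫ k, (lapAtomsAt d cΦ αΦ cF αF RΦ RF k).H1 * (lapAtomsAt d cΦ αΦ cF αF RΦ RF k).G ^ n *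
        Dhat d k ^ l * DhatSym d x k ∂P d) / (2 * π) ^ d| ≤ B₁)
    (hH2 : |(∫ k, (lapAtomsAt d cΦ αΦ cF αF RΦ RF k).H2 * (lapAtomsAt d cΦ αΦ cF αF RΦ RF k).G ^ n *
        Dhat d k ^ l * DhatSym d x k ∂P d) / (2 * π) ^ d| ≤ B₂)
    (hH3 : |(∫ k, (lapAtomsAt d cΦ αΦ cF αF RΦ RF k).H3 * (lapAtomsAt d cΦ αΦ cF αF RΦ RF k).G ^ n *
        Dhat d k ^ l * DhatSym d x k ∂P d) / (2 * π) ^ d| ≤ B₃)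
    (hH4 : |(∫ k, (lapAtomsAt d cΦ αΦ cF αF RΦ RF k).H4 * (lapAtomsAt d cΦ αΦ cF αF RΦ RF k).G ^ n *
        Dhat d k ^ l * DhatSym d x k ∂P d) / (2 * π) ^ d| ≤ B₄)
    (hH5 : |(∫ k, (lapAtomsAt d cΦ αΦ cF αF RΦ RF k).H5 * (lapAtomsAt d cΦ αΦ cF αF RΦ RF k).G ^ n *
        Dhat d k ^ l * DhatSym d x k ∂P d) / (2 * π) ^ d| ≤ B₅) :
    |nobleH d n l p x| ≤ B₁ + B₂ + B₃ + B₄ + B₅ := by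
  have hae := ae_nobleH_integrand_eq_sum_pieces hd hp hRΦ hRF hRΦ2 hRF2 hform hKB n l x
  have hI12 : Integrable (fun k =>
      (lapAtomsAt d cΦ αΦ cF αF RΦ RF k).H1 * (lapAtomsAt d cΦ αΦ cF αF RΦ RF k).G ^ n * Dhat d k ^ l * DhatSym d x k +
      (lapAtomsAt d cΦ αΦ cF αF RΦ RF k).H2 * (lapAtomsAt d cΦ αΦ cF αF RΦ RF k).G ^ n * Dhat d k ^ l * DhatSym d x k) (P d) :=
    hI1.add hI2
  have hI123 : Integrable (fun k =>
      (lapAtomsAt d cΦ αΦ cF αF RΦ RF k).H1 * (lapAtomsAt d cΦ αΦ cF αF RΦ RF k).G ^ n * Dhat d k ^ l * DhatSym d x k +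
      (lapAtomsAt d cΦ αΦ cF αF RΦ RF k).H2 * (lapAtomsAt d cΦ αΦ cF αF RΦ RF k).G ^ n * Dhat d k ^ l * DhatSym d x k +
      (lapAtomsAt d cΦ αΦ cF αF RΦ RF k).H3 * (lapAtomsAt d cΦ αΦ cF αF RΦ RF k).G ^ n * Dhat d k ^ l * DhatSym d x k) (P d) :=
    hI12.add hI3
  have hI1234 : Integrable (fun k =>
      (lapAtomsAt d cΦ αΦ cF αF RΦ RF k).H1 * (lapAtomsAt d cΦ αΦ cF αF RΦ RF k).G ^ n * Dhat d k ^ l * DhatSym d x k +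
      (lapAtomsAt d cΦ αΦ cF αF RΦ RF k).H2 * (lapAtomsAt d cΦ αΦ cF αF RΦ RF k).G ^ n * Dhat d k ^ l * DhatSym d x k +
      (lapAtomsAt d cΦ αΦ cF αF RΦ RF k).H3 * (lapAtomsAt d cΦ αΦ cF αF RΦ RF k).G ^ n * Dhat d k ^ l * DhatSym d x k +
      (lapAtomsAt d cΦ αΦ cF αF RΦ RF k).H4 * (lapAtomsAt d cΦ αΦ cF αF RΦ RF k).G ^ n * Dhat d k ^ l * DhatSym d x k) (P d) :=
    hI123.add hI4
  rw [nobleH_eq_integral hd n l p hp x, integral_congr_ae hae, integral_add hI1234 hI5, integral_add hI123 hI4,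
    integral_add hI12 hI3, integral_add hI1 hI2]
  simp only [add_div]
  refine le_trans (abs_add_le _ _) ?_
  refine le_trans (add_le_add (abs_add_le _ _) le_rfl) ?_
  refine le_trans (add_le_add (add_le_add (abs_add_le _ _) le_rfl) le_rfl) ?_
  refine le_trans (add_le_add (add_le_add (add_le_add (abs_add_le _ _) le_rfl) le_rfl) le_rfl) ?_
  exact add_le_add (add_le_add (add_le_add (add_le_add hH1 hH2) hH3) hH4) hH5

end Literature.Probability.FitznerVanDerHofstad2017

end
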